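import Summits.CriticalPhenomena.PercolationContinuityZ3.Theorems.Transplant.FKConnectivityAllQWheelHub
import Summits.CriticalPhenomena.PercolationContinuityZ3.Theorems.Transplant.FKConnectivityAllQWheelRimSpokeSame
import HarnessLib

/-!
# Connectivity correlation inequalities for `φ_{w,q}`, every `q > 0` — WHEELS ARE POTTS–RAYLEIGH FOR EVERY `0 < q ≤ 1`:
# edge-negative association `EdgeNegCorrSupp` on the support of every wheel `W_n` (`n ≥ 3` rim vertices, any weights)

Support file (`--supports stmt-CriticalPhenomena-4575`), FK sub-lane `prim-bschramm-fk-3` (gen 8) of the post-continuity programme; builds on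
p205010 (kernel theorem, internal audit signed; external expert review pending).  No definitions, no named facts, no sorries; standard axioms.

**`FK.Wheel.edgeNegCorrSupp_wheel`**: for `V` finite with `Fintype.card V = n + 1`, `n ≥ 3`, a hub `x`, pairwise distinct rim vertices
`v 0, …, v (n−1)` (`≠ x`) and `0 < q ≤ 1`: `EdgeNegCorrSupp ↑(wheelPairs x v n) q` — for EVERY weight vector supported on the wheel pairs and every two
distinct pairs `e ≠ f`, `φ_{w,q}(J_e ∩ J_f) ≤ φ_{w,q}(J_e)·φ_{w,q}(J_f)`.  Assembly of THEOREM W (spoke/spoke, `…AllQWheelNegCorr`), THEOREM W′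
(rim/rim, `…AllQWheelRimNegCorr`) and THEOREM W″ (rim/spoke, `…AllQWheelRimSpokeNegCorr`, `…AllQWheelRimSpokeSame`); pairs off the support have
probability `0`.  Wheels `W_n` (`n ≥ 4`) are 3-connected and not series–parallel: the first infinite family of graphs with a `K₄` minor, beyond
Wagner's two-sum class, on which the random-cluster measure is known to be edge-negatively associated for all `q < 1` (Grimmett 2006, §3.9,
Conj. (3.96); Wagner 2008, Conj. 5.3, §5.3).  Method: bschramm/prim-bschramm-fk-3/WHEELS-HUB-NC.md (cyclic 2×2 transfer formula, rigid interpolation,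
word invariants). [cite: Grimmett2006, §3.9 eq. (3.94), Conj. (3.96) (pp. 63–66)] [cite: Wagner2006, Conj. 5.3, Thm. 5.8, §5.3 (pp. 13–15)]
-/

noncomputable section

namespace Summit.CriticalPhenomena.PercolationContinuityZ3.Theorems

namespace FK

namespace Wheel

open MeasureTheory Set Literature.Probability.LatticeModels Literature.Probability.Percolation
open scoped Classical

variable {V : Type*} [Fintype V]

/-- A pair of weight `0` is almost surely closed: `φ_w(J_f) = 0`. [cite: Grimmett2006, §1.4 eq. (1.20) (p. 15)] -/
theorem real_openPair_eq_zero_of_zero (w : Sym2 V → unitInterval) {q : ℝ} (hq0 : 0 < q) {f : Sym2 V}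
    (hf : ((w f : unitInterval) : ℝ) = 0) : (rcMeasureW w q ∅).real {ω : BondConfig V | f ∈ ω} = 0 := by
  rw [rcMeasureW_real_eq_sum_div w hq0, sum_openPair_eq_mul_Z w q f, hf, zero_mul, zero_div]

/-- Negative correlation is trivial when one of the two pairs has weight `0`. [cite: Grimmett2006, §1.4 eq. (1.20) (p. 15)] -/
theorem negCorr_of_zero_right (w : Sym2 V → unitInterval) {q : ℝ} (hq0 : 0 < q) (e : Sym2 V) {f : Sym2 V}
    (hf : ((w f : unitInterval) : ℝ) = 0) :
    (rcMeasureW w q ∅).real ({ω : BondConfig V | e ∈ ω} ∩ {ω | f ∈ ω}) ≤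
      (rcMeasureW w q ∅).real {ω : BondConfig V | e ∈ ω} * (rcMeasureW w q ∅).real {ω : BondConfig V | f ∈ ω} := by
  haveI := isProbabilityMeasure_rcMeasureW w hq0 (∅ : Set V)
  have h0 := real_openPair_eq_zero_of_zero w hq0 hf
  rw [h0, mul_zero]
  exact (measureReal_mono (μ := rcMeasureW w q ∅) (Set.inter_subset_right : ({ω : BondConfig V | e ∈ ω} ∩ {ω | f ∈ ω}) ⊆ {ω | f ∈ ω})
    (measure_ne_top _ _)).trans h0.le

/-- Negative correlation is trivial when one of the two pairs has weight `0` (left version). [cite: Grimmett2006, §1.4 eq. (1.20) (p. 15)] -/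
theorem negCorr_of_zero_left (w : Sym2 V → unitInterval) {q : ℝ} (hq0 : 0 < q) {e : Sym2 V} (f : Sym2 V)
    (he : ((w e : unitInterval) : ℝ) = 0) :
    (rcMeasureW w q ∅).real ({ω : BondConfig V | e ∈ ω} ∩ {ω | f ∈ ω}) ≤
      (rcMeasureW w q ∅).real {ω : BondConfig V | e ∈ ω} * (rcMeasureW w q ∅).real {ω : BondConfig V | f ∈ ω} := by
  rw [Set.inter_comm, mul_comm]
  exact negCorr_of_zero_right w hq0 f he

section Main

variable {x : V} {v : ℕ → V} {n : ℕ}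
variable (hn : 3 ≤ n) (hinj : ∀ j k, j < n → k < n → v j = v k → j = k) (hx : ∀ j, j < n → v j ≠ x) (hcard : Fintype.card V = n + 1)
include hn hinj hx hcard

/-- **THEOREM W″, free indexing**: every rim pair `s(v j, v (j+1))` and every spoke `s(x, v k)` (`j, k < n`) of a weighted wheel are negatively
correlated under `φ_{w,q}`, `0 < q ≤ 1` — incident (`k ∈ {j, j+1}`) or not. (transcription of bschramm/prim-bschramm-fk-3/WHEELS-HUB-NC.md §10) -/
theorem wheel_negCorr_rim_spoke_of_lt {q : ℝ} (hq0 : 0 < q) (hq1 : q ≤ 1) (w : Sym2 V → unitInterval)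
    (hsupp : ∀ e, e ∉ wheelPairs x v n → w e = 0) {j k : ℕ} (hj : j < n) (hk : k < n) :
    (rcMeasureW w q ∅).real ({ω : BondConfig V | rimPair v n j ∈ ω} ∩ {ω | spokePair x v n k ∈ ω}) ≤
      (rcMeasureW w q ∅).real {ω : BondConfig V | rimPair v n j ∈ ω} * (rcMeasureW w q ∅).real {ω : BondConfig V | spokePair x v n k ∈ ω} := by
  by_cases hjk : k = j
  · subst hjk
    exact wheel_negCorr_rim_spoke_same hn hinj hx hcard hq0 hq1 w hsupp hj
  · -- `k ≡ j + d (mod n)` with `1 ≤ d ≤ n − 1`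
    obtain ⟨d, hd1, hdn, hdk⟩ : ∃ d, 1 ≤ d ∧ d + 1 ≤ n ∧ (j + d) % n = k := by
      rcases lt_or_gt_of_ne hjk with h | h
      · exact ⟨k + n - j, by omega, by omega, by rw [show j + (k + n - j) = k + n by omega, Nat.add_mod_right, Nat.mod_eq_of_lt hk]⟩
      · exact ⟨k - j, by omega, by omega, by rw [show j + (k - j) = k by omega, Nat.mod_eq_of_lt hk]⟩
    have key := wheel_negCorr_rim_spoke hn hinj hx hcard hq0 hq1 w hsupp hj hd1 hdn
    rwa [← spokePair_mod x v n (j + d), hdk] at key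

/-- **WHEELS ARE POTTS–RAYLEIGH FOR EVERY `0 < q ≤ 1`**: edge-negative association `EdgeNegCorrSupp ↑(wheelPairs x v n) q` — for every weight vector
supported on the pairs of the wheel with hub `x` and rim `v 0, …, v (n−1)` (`n ≥ 3`, `Fintype.card V = n + 1`) and every two distinct pairs `e ≠ f`,
`φ_{w,q}(J_e ∩ J_f) ≤ φ_{w,q}(J_e)·φ_{w,q}(J_f)`. (transcription of bschramm/prim-bschramm-fk-3/WHEELS-HUB-NC.md §0, §10)
[cite: Grimmett2006, §3.9 eq. (3.94), Conj. (3.96) (pp. 63–66)] [cite: Wagner2006, Conj. 5.3, §5.3 (pp. 13–15)] -/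
theorem edgeNegCorrSupp_wheel {q : ℝ} (hq0 : 0 < q) (hq1 : q ≤ 1) : EdgeNegCorrSupp (↑(wheelPairs x v n) : Set (Sym2 V)) q := by
  intro w hw e f _ hfe
  have hsupp : ∀ g, g ∉ wheelPairs x v n → w g = 0 := supp_of_real_supp w hw
  by_cases he0 : ((w e : unitInterval) : ℝ) = 0
  · exact negCorr_of_zero_left w hq0 f he0
  by_cases hf0 : ((w f : unitInterval) : ℝ) = 0
  · exact negCorr_of_zero_right w hq0 e hf0
  have he := (mem_wheelPairs_iff (x := x) (v := v) (n := n) e).1 (Finset.mem_coe.1 (hw e he0))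
  have hf := (mem_wheelPairs_iff (x := x) (v := v) (n := n) f).1 (Finset.mem_coe.1 (hw f hf0))
  rcases he with ⟨j, hj, rfl⟩ | ⟨j, hj, rfl⟩ <;> rcases hf with ⟨k, hk, rfl⟩ | ⟨k, hk, rfl⟩
  · -- spoke / spoke
    have hjk : j ≠ k := fun h => hfe (by rw [h])
    exact wheel_negCorr_spokes_of_ne hn hinj hx hcard hq0 hq1 w hsupp hj hk hjk
  · -- spoke / rim
    rw [Set.inter_comm, mul_comm]
    exact wheel_negCorr_rim_spoke_of_lt hn hinj hx hcard hq0 hq1 w hsupp hk hj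
  · -- rim / spoke
    exact wheel_negCorr_rim_spoke_of_lt hn hinj hx hcard hq0 hq1 w hsupp hj hk
  · -- rim / rim
    have hjk : j ≠ k := fun h => hfe (by rw [h])
    exact wheel_negCorr_rims_of_ne hn hinj hx hcard hq0 hq1 w hsupp hj hk hjk

/-- **Every pair slice**: `NegCorrPairSupp ↑(wheelPairs x v n) q e f` for all `e ≠ f`, `0 < q ≤ 1`. (transcription of bschramm/prim-bschramm-fk-3/WHEELS-HUB-NC.md §0)
[cite: Grimmett2006, §3.9 eq. (3.94) (p. 63)] -/
theorem negCorrPairSupp_wheel {q : ℝ} (hq0 : 0 < q) (hq1 : q ≤ 1) {e f : Sym2 V} (hfe : f ≠ e) :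
    NegCorrPairSupp (↑(wheelPairs x v n) : Set (Sym2 V)) q e f := by
  intro w hw
  by_cases hd : e.IsDiag
  · -- a diagonal pair is not a wheel pair, so it has weight `0`
    have he0 : ((w e : unitInterval) : ℝ) = 0 := by
      by_contra h
      have hmem := (mem_wheelPairs_iff (x := x) (v := v) (n := n) e).1 (Finset.mem_coe.1 (hw e h))
      rcases hmem with ⟨j, hj, rfl⟩ | ⟨j, hj, rfl⟩
      · exact hx (j % n) (Nat.mod_lt _ (by omega)) (Sym2.mk_isDiag_iff.1 hd).symm
      · have h2 := Sym2.mk_isDiag_iff.1 hd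
        have := hinj _ _ (Nat.mod_lt _ (by omega)) (Nat.mod_lt _ (by omega)) h2
        rcases Nat.eq_zero_or_pos n with h0 | hnpos
        · omega
        · have := mod_add_ne_mod (i := j) (t := 1) (n := n) (by omega) (by omega)
          exact this (by rw [Nat.add_comm] at *; omega)
    exact negCorr_of_zero_left w hq0 f he0
  · exact edgeNegCorrSupp_wheel hn hinj hx hcard hq0 hq1 w hw e f hd hfe

end Main

end Wheel

end FK

end Summit.CriticalPhenomena.PercolationContinuityZ3.Theorems
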